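import Summits.BirchSwinnertonDyer.BirchSwinnertonDyer.Theses.PrintX10b
import Summits.BirchSwinnertonDyer.BirchSwinnertonDyer.Theorems.PrintX10bHowardContainmentAnyClassNumberX10bEvenDiscOfCornutVatsal
import Summits.BirchSwinnertonDyer.BirchSwinnertonDyer.Theorems.PrintX10bUntiedHowardContainmentOfKolyvaginSystemLeaf
import Literature.NumberTheory.EllipticCurves.CastellaGrossiSkinner2025.LambdaAdicKolyvaginSystemBound
import Literature.NumberTheory.EllipticCurves.HeegnerHypothesisKroneckerProofs
import HarnessLib

/-!
# `HowardContainmentAnyClassNumberX10b` (stmt-BirchSwinnertonDyer-23729) from CGS 2025 Thm. 6.5.1 (the ABSTRACT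
# Kolyvagin-system bound, record-free leaf `thm651_…_of_kolyvaginSystem`, p699162) and a Kolyvagin system AT THE FRAME —
# the residual of the crux cut down to «the Heegner-point Kolyvagin system EXISTS on the even-`d_K`, `3 ∣ h_K` frames»

Cell `pub/bsd-print-x9`, seat `bsd-line-x10b-p2` (LEAD g12), write-crux stmt-BirchSwinnertonDyer-23729 (OPEN·aside; PIN-1 / R0).
THEOREMS ONLY (`--supports 23729`); no definition, no named fact, no `sorry`, no instance.

CONTEXT. p696955 (this seat) proved the untied containment PARITY-FREE from Cornut–Vatsal + «CGS 2025 Thm. 6.5.2 (i)–(ii) at the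
frame», leaving as 23729's residual «Thm. 6.5.2's conclusion on the even-`d_K`, `3 ∣ h_K` X10b frames». The cell's literature
desk (lit g45, DOSSIER §74) and referee (REF-157) ruled that Thm. 6.5.2 CARRIES CGLS 2022's (disc) by citation-import
(«κ^{Hg} of [CGLS22, Thm. 4.1.1]»), and — on this seat's request — typed Math. Ann. 393 Thm. 6.5.1, the ABSTRACT
Kolyvagin-system theorem, which is printed under the §6 standing hypotheses ONLY (no (Heeg), no (disc)), RECORD-FREE:
`CastellaGrossiSkinner2025.thm651_rankOne_charIdeal_torsion_dvd_pLocalized_of_kolyvaginSystem` over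
`CastellaGrossiSkinner2025.thm651Setting` (= `CastellaGrossiLeeSkinner2022.thm411Setting` with `hyp.level ↦ hN`, by `rfl`).

WHAT THIS FILE PROVES (kernel):
* §1 **`howardContainment_untied_localized_of_thm651_of_ksAt`** — the parity-free, class-free core from Thm. 6.5.1 (`h651`) and
  a frame-local hypothesis `hKSAt` = the BODY of CGLS 2022 Thm. 4.1.1 in Kolyvagin-system form (F-411,
  `thm411_exists_kolyvaginSystem_one_ne_zero`) AT THE FRAME over `thm651Setting` («for every `D C z` with `z = κ_∞(C)` and
  every choice of presentation slots there is a Kolyvagin system `κ` with `κ₁ ≠ 0` on the `Λ`-line of `Φ′(z)`»): coherent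
  pair WITH CLASS (`exists_coherent_pair_envelope_class`: `Λκ_∞(C) = Λ ∙ z`), the slots filled by tree data exactly as in
  `HeegnerStabilizedOfKSLeaf.stabilizedClass_ne_zero_of_kolyvaginSystemLeaf` / `PrintX9MuPartStubAKSLink.ne_zero_of_thm411`
  (tame pins `nonempty_tamePin`, guard = the level pairs, `πbar = 0`, `cd = ConjugationDatum.ofLifts`, source H.4 data
  `shapiroDualityDataUnitTwist`), Thm. 6.5.1 at `(D, X, z, κ)`, `z ≠ 0` from `κ₁ ≠ 0` (`Φ′` additive), torsion of
  `𝔖/Λκ_∞(C)` by rank–nullity, envelopes. NO Cornut–Vatsal leaf, NO Thm. 6.5.2 leaf, NO `Odd d_K`, NO class number.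
* §2 `howardContainmentAnyClassNumberX10b_at_of_thm651_of_ksAt` — on ANY X10b Heegner frame of 23729 (fields are theorems on
  class X10b; μ-blind promotion `PrintX9Rescaling.howardContainment_of_localized_family`).
* §3 `ksAt_oddDisc_of_kolyvaginSystemLeaf` — on ODD-`d_K` X10b frames `hKSAt` IS the leaf F-411 = `CGLSHeegnerKolyvaginSystem`
  (23236) at the frame's `Thm413Hypotheses` (`thm411Setting_eq_thm651Setting`, `rfl`).
* §4 **CENSUS III `howardContainmentAnyClassNumberX10b_of_thm651_ksLeaf_mz_of_ksOnEvenFrames :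
  thm651_… → CGLSHeegnerKolyvaginSystem → MastellaZermanHowardDivisibility → KS^{R_even} → HowardContainmentAnyClassNumberX10b`**
  — the crux BY NAME from THREE cite-only print leaves (CGS25 Thm. 6.5.1 record-free; CGLS22 Thm. 4.1.1 = 23236; MZ26 Cor. 4.6 =
  25233) and the ONE residual `KS^{R_even}` := F-411's conclusion (Kolyvagin system with `κ₁ ≠ 0` on the line of `Φ′(κ_∞(C))`)
  over `thm651Setting` on the X10b frames with `d_K` EVEN (`≠ -4`) and `3 ∣ h_K` — i.e. F-411 with its (disc) field deleted,
  restricted to those frames: «the Heegner-point Kolyvagin system exists there» (Howard 2004 §2.3 / CGLS 2022 «almost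
  verbatim» at `p ∣ h_K`, `κ₁ ≠ 0` by Cornut–Vatsal) — the genuinely beyond-typed-print statement (lit g45 §74.3 (β)).

HONEST FRAMING. (i) Kernel-valid AS TYPED and CONDITIONAL on the named leaves and on the frame-local hypothesis `hKSAt` /
`KS^{R_even}` (a HYPOTHESIS, equal to the leaf 23236 on odd `d_K` only, §3); (ii) PIN-1 / R0 stand (`F := p^m • F₀`): not route
currency, no `closes` changes; (iii) 23729 AS FILED stays open; its census of record becomes «⟸ 6.5.1 + 23236 + 25233 +
KS^{R_even}». «beyond-print theorem»: no. No summit statement is proved; BSD is NOT proved by any of this.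

References: [CastellaGrossiSkinner2025] Thm. 6.5.1 (final TeX l.3213–3227; v1 Thm. 5.5.1 p. 26), §6 standing (l.2259–2262);
[CastellaGrossiLeeSkinner2022] Thm. 4.1.1, Rem. 4.1.4, §4.1 standing (Heeg)+(disc) (arXiv:2008.02571v2 TeX L2186, L248–249);
[MastellaZerman2026] Cor. 4.6; [Howard2004HeegnerKolyvagin] §1.3 (H.4/H.5(a)), Def. 1.2.3, §2.3, Thm. B; [PerrinRiou1987BSMF] §1 p. 405.
-/

set_option linter.dupNamespace false
set_option autoImplicit false

noncomputable section
open scoped Classical Pointwise NumberField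
open Field IsDedekindDomain
open Literature Literature.NumberTheory.EllipticCurves WeierstrassCurve
  Literature.NumberTheory.EllipticCurves.ModularForms Literature.NumberTheory.EllipticCurves.ZpExtension
  Literature.NumberTheory.EllipticCurves.CastellaGrossiLeeSkinner2022
  Literature.NumberTheory.GaloisCohomology.Howard2004 Literature.NumberTheory.GaloisRepresentations
  Literature.NumberTheory.GaloisRepresentations.DiscreteGaloisModule
open Literature.NumberTheory.EllipticCurves.Rank1Residual (ClassX10 Surj)
open Summit.BirchSwinnertonDyer.BirchSwinnertonDyer.Theses.PrintX10b
open Summit.BirchSwinnertonDyer.BirchSwinnertonDyer.Theorems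

namespace Summit.BirchSwinnertonDyer.BirchSwinnertonDyer.Theorems.PrintX10bOfKSBound

/-! ## §1 The parity-free core from Thm. 6.5.1 and a Kolyvagin system AT the frame -/

/-- Ideal bookkeeping: `(a) · ((b) · I)² = (a·b²) · I²`. [folklore] -/
private theorem span_singleton_mul_sq {R : Type*} [CommSemiring R] (a b : R) (I : Ideal R) :
    Ideal.span {a} * (Ideal.span {b} * I) ^ 2 = Ideal.span {a * b ^ 2} * I ^ 2 := by
  rw [mul_pow, Ideal.span_singleton_pow, ← mul_assoc, Ideal.span_singleton_mul_span_singleton]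

/-- `(d_K, pN) = 1` on a frame: `p` and every prime of `N` split in `K`, hence are unramified (tree:
`Literature.SatisfiesHeegnerHypothesis.coprime_discr`). The §6 standing hypothesis «`D_K` prime to `Np`» of Thm. 6.5.1.
[cite: CastellaGrossiSkinner2025, §6 standing hypotheses (final TeX l.2259–2262)] -/
theorem isCoprime_discr_mul_of_heegner {K : Type} [Field K] [NumberField K] (hK : IsImaginaryQuadratic K) {p N : ℕ}
    (hHp : SatisfiesHeegnerHypothesis p K) (hHN : SatisfiesHeegnerHypothesis N K) :
    IsCoprime (NumberField.discr K) ((p * N : ℕ) : ℤ) := by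
  have hHpN : SatisfiesHeegnerHypothesis (p * N) K := fun ℓ hℓ hdvd ↦
    ((Nat.Prime.dvd_mul hℓ).mp hdvd).elim (fun h ↦ hHp ℓ hℓ h) (fun h ↦ hHN ℓ hℓ h)
  refine Int.isCoprime_iff_gcd_eq_one.mpr ?_
  rw [Int.gcd_eq_natAbs, Int.natAbs_natCast]
  exact (Literature.SatisfiesHeegnerHypothesis.coprime_discr hK.1 hHpN).symm

/-- **The `p`-localized untied Howard containment, parity-free and class-free, from CGS 2025 Thm. 6.5.1 and a Heegner-point
Kolyvagin system AT THE FRAME.** Frame given field by field (`p ≠ 2` good ordinary, `p ∤ N_E`, `K` imaginary quadratic with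
`d_K < -4`, (Heeg) for `N_E` and for `p`, (h1) `E(K)[p] = 0`, `κ` anticyclotomic with topological generator `γ`), for given
`jbar`, `Dt`, `H`. Inputs: `h651` (the record-free leaf) and `hKSAt` = the body of F-411 at this frame over `thm651Setting` (for
all `D C z` with `proj_k z = δ(κ_k(C))` above the torsion depth and all presentation slots: a Kolyvagin system `κ` with
`κ.one ≠ 0`, `κ.one = a • Φ′(z)`, `Φ′(z) = b • κ.one`). Output: `D`, a Heegner family `F` ON `(Dt, H.β)`, `X`, `m` with `𝔖`
finitely generated of `Λ`-rank one, `𝔖/ℋ_∞(F)` torsion and `(p^m) · I(ℋ_∞(F))² ⊆ char_Λ(X_{Λ-tors})`. Steps: coherent pair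
with class (`Λκ_∞(C) = Λ ∙ z`); slots as in `HeegnerStabilizedOfKSLeaf`; Thm. 6.5.1 at `(D, X, z, κ)`: rank one, `char = J²`,
`J ∣ (p^m)·char(𝔖 ⧸ Λ ∙ z)`; `z ≠ 0` (from `κ.one ≠ 0`, `Φ′` additive); rank–nullity; envelopes.
[cite: CastellaGrossiSkinner2025, Thm. 6.5.1 (i)–(ii)] [cite: CastellaGrossiLeeSkinner2022, Thm. 4.1.1, Rem. 4.1.4]
[cite: Howard2004HeegnerKolyvagin, §1.3 (H.4, H.5(a)), Def. 1.2.3] [cite: PerrinRiou1987BSMF, §1 p. 405, §3.4 Prop. 10] -/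
theorem howardContainment_untied_localized_of_thm651_of_ksAt
    (h651 : CastellaGrossiSkinner2025.thm651_rankOne_charIdeal_torsion_dvd_pLocalized_of_kolyvaginSystem)
    {W : WeierstrassCurve ℚ} [W.IsElliptic] [W.IsGloballyMinimal] [NeZero (W.conductorNorm ℤ)] {p : ℕ} [Fact p.Prime]
    {K : Type} [Field K] [NumberField K] {κ : ZpExtension K p} {γ : Field.absoluteGaloisGroup K}
    (hp2 : p ≠ 2) (hord : IsOrdinaryAt W p) (hpN : ¬ p ∣ W.conductorNorm ℤ)
    (hK : IsImaginaryQuadratic K) (hlt : NumberField.discr K < -4)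
    (hHN : SatisfiesHeegnerHypothesis (W.conductorNorm ℤ) K) (hHp : SatisfiesHeegnerHypothesis p K)
    (hE : ∀ Q : (W.baseChange K).toAffine.Point, p • Q = 0 → Q = 0)
    (hac : κ.IsAnticyclotomic) (hγ : κ.IsTopGenerator γ) (jbar : AlgebraicClosure K →+* ℂ)
    (Dt : ModularParametrizationData W (W.conductorNorm ℤ)) (H : HeegnerDatum (W.conductorNorm ℤ) (NumberField.discr K))
    (hKSAt : ∀ (D : (W.baseChange K).LambdaAdicSelmerData κ γ) (C : StabilizedHeegnerData (W.conductorNorm ℤ) W K κ jbar)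
      (z : D.S) (_hz : ∀ (k : ℕ) (hk : C.depth < k), D.proj k z ∈ stabilizedClassLayer C k hk)
      (π : ∀ v : HeightOneSpectrum (𝓞 K), TamePin v)
      (P : Finset (HeightOneSpectrum (𝓞 K)) → HeightOneSpectrum (𝓞 K) → Prop)
      (hP : ∀ j n v, P n v → TameHyp (fun n ↦ W.shapiroLevelQuot (κ.unitTwist (-1)) j n) n v)
      (_hPlev : ∀ n ∈ levels (heegnerKolyvaginPrimes W (κ.unitTwist (-1))
          (placesDividing K (p * W.conductorNorm ℤ) mul_level_ne_zero)), ∀ v ∈ n, P n v)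
      (cd : ConjugationDatum K),
      letI := W.shapiroResidueModule K p
      ∀ (πbar : ∀ j, W.ShapiroLevel K p j →ₗ[IwasawaAlgebra p ⧸ shapiroIdeal p (j + 1)] (W.baseChange K).geomTorsion (p : ℤ))
        (Dsrc : ∀ j, DualityDatum p cd ((W.shapiroTower K p (κ.unitTwist (-1))).ρ j) (IwasawaAlgebra p ⧸ shapiroIdeal p (j + 1))),
      ∃ κKS : (CastellaGrossiSkinner2025.thm651Setting (W.conductorNorm ℤ) W K p κ rfl jbar π P hP cd πbar Dsrc).KolyvaginSystem,
        κKS.one ≠ 0 ∧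
        (∃ a : IwasawaAlgebra p, κKS.one =
          (W.shapiroTower K p (κ.unitTwist (-1))).smulFamily a (W.toShapiroSuccLimitH1 D hγ hE z).1) ∧
        (∃ b : IwasawaAlgebra p, (W.toShapiroSuccLimitH1 D hγ hE z).1 =
          (W.shapiroTower K p (κ.unitTwist (-1))).smulFamily b κKS.one)) :
    ∃ (D : (W.baseChange K).LambdaAdicSelmerData κ γ) (F : HeegnerFamily (W.conductorNorm ℤ) W K κ jbar)
      (X : (W.baseChange K).SelmerDualData κ γ) (m : ℕ),
      F.Dt = Dt ∧ F.β = H.β ∧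
      Module.Finite (IwasawaAlgebra p) D.S ∧ Module.finrank (IwasawaAlgebra p) D.S = 1 ∧
      Module.IsTorsion (IwasawaAlgebra p) (D.S ⧸ heegnerModule D F) ∧
      Ideal.span {((p : IwasawaAlgebra p) ^ m)} * heegnerCharIdeal D F ^ 2 ≤
        Module.charIdeal (IwasawaAlgebra p) (Submodule.torsion (IwasawaAlgebra p) X.X) := by
  have hp : p.Prime := Fact.out
  have hp_odd : Odd p := hp.odd_of_ne_two hp2
  -- the data `𝔖`, `X`
  obtain ⟨D⟩ := LambdaAdicSelmerDataExists.nonempty_lambdaAdicSelmerData (W.baseChange K) p κ hγ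
  obtain ⟨X⟩ := (W.baseChange K).nonempty_selmerDualData_holds κ γ hγ
  -- the coherent pair on `(Dt, H.β)` WITH its class `z = κ_∞` (`Λκ_∞(C) = Λ ∙ z`)
  obtain ⟨C, F, -, hFDt, -, hFβ, hfwd, ⟨g, hg, hrev⟩, z, hz, hcyc⟩ :=
    exists_coherent_pair_envelope_class (W := W) hK hHN Dt H.dvd_sq_sub jbar hord hpN κ hγ
      (fun k ↦ anticyclotomicTowerSharp K p hp_odd hK κ hac jbar k)
      (PrintX10bEvenDiscOfCornutVatsal.card_ringClassGalOver_prime_one_of_discr_lt hK hlt hp hHp jbar) hE D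
  have hfwd' : ((p : IwasawaAlgebra p) ^ 0) • heegnerModule D F ≤ stabilizedHeegnerModule D C := by
    rw [pow_zero, one_smul]
    exact hfwd
  -- the presentation slots, filled by tree data (as in `HeegnerStabilizedOfKSLeaf.stabilizedClass_ne_zero_of_kolyvaginSystemLeaf`)
  haveI : NumberField.IsTotallyComplex K := hK.isTotallyComplex
  have himag : ∀ w : NumberField.InfinitePlace K, w.IsComplex := fun w ↦ NumberField.IsTotallyComplex.isComplex w
  obtain ⟨c₀, hc₀⟩ := exists_isComplexConjugation (Rat.castHom ℝ)
  obtain ⟨σ, hσ₁, hσ, hτl, hτ₂, -, hτ⟩ := exists_conjugationDatum_ofLifts_τ_eq_absGaloisTransport hK hc₀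
  letI := W.shapiroResidueModule K p
  -- the Kolyvagin system AT the frame (guard = the level pairs, zero residual presentation)
  obtain ⟨κKS, hne, ha, hb⟩ := hKSAt D C z hz (fun v ↦ (nonempty_tamePin v).some)
    (fun n v ↦ n ∈ levels (heegnerKolyvaginPrimes W (κ.unitTwist (-1))
      (placesDividing K (p * W.conductorNorm ℤ) mul_level_ne_zero)) ∧ v ∈ n)
    (W.shapiroTameHyp_of_mem_levels (κ.unitTwist (-1)) (placesDividing K (p * W.conductorNorm ℤ) mul_level_ne_zero)
      (fun _ hv ↦ mem_placesDividing_of_dvd mul_level_ne_zero (dvd_mul_right p (W.conductorNorm ℤ)) hv)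
      (fun _ hv _ ↦ hasGoodReductionAt_of_not_mem_placesDividing W rfl mul_level_ne_zero hv)
      (heegnerKolyvaginPrimes W (κ.unitTwist (-1)) (placesDividing K (p * W.conductorNorm ℤ) mul_level_ne_zero))
      (heegnerKolyvaginPrimes_subset_degreeTwoPrimes W (κ.unitTwist (-1)) _)
      (fun _ hv ↦ not_mem_of_mem_heegnerKolyvaginPrimes W (κ.unitTwist (-1)) _ hv))
    (fun n hn v hv ↦ ⟨hn, hv⟩) (ConjugationDatum.ofLifts σ hσ₁ hσ _ hτl hτ₂) (fun _ ↦ 0)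
    (W.shapiroDualityDataUnitTwist _ κ (-1) hac himag hc₀ hτ)
  -- Thm. 6.5.1 at `(D, X, z, κ)`: `𝔖` f.g. of `Λ`-rank one, `char(X_tors) = J²`, `J ∣ (p^m)·char(𝔖 ⧸ Λ ∙ z)`
  obtain ⟨⟨hSfin, hS1⟩, -, -, J, m, hJ, hdvd⟩ := h651 (W.conductorNorm ℤ) W K p κ γ jbar rfl hp2 hord hK
    (isCoprime_discr_mul_of_heegner hK hHp hHN) hE hac hγ D X z _ _ _ (fun n hn v hv ↦ ⟨hn, hv⟩) _ _ _ κKS hne ha hb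
  haveI : Module.Finite (IwasawaAlgebra p) D.S := hSfin
  rw [← hcyc] at hdvd
  have hm : Ideal.span {((p : IwasawaAlgebra p) ^ (m * 2))} * stabilizedHeegnerCharIdeal D C ^ 2 ≤
      Module.charIdeal (IwasawaAlgebra p) (Submodule.torsion (IwasawaAlgebra p) X.X) := by
    have h2 := pow_dvd_pow_of_dvd hdvd 2
    rw [mul_pow, Ideal.span_singleton_pow, ← pow_mul, ← hJ] at h2
    exact Ideal.le_of_dvd h2
  -- `z ≠ 0` (from `κ.one ≠ 0` and `κ.one = a • Φ′(z)`, `Φ′` additive), torsion of `𝔖/Λκ_∞(C)` by rank–nullity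
  have hz0 : z ≠ 0 := by
    rintro rfl
    obtain ⟨a, ha⟩ := ha
    exact hne (by rw [ha, map_zero]; exact smulFamily_zero _ a)
  have hne' : stabilizedHeegnerModule D C ≠ ⊥ := by
    rw [hcyc, Ne, Submodule.span_singleton_eq_bot]
    exact hz0
  have htorC : Module.IsTorsion (IwasawaAlgebra p) (D.S ⧸ stabilizedHeegnerModule D C) :=
    PrintX10bEvenDiscOfCornutVatsal.isTorsion_quotient_of_finrank_eq_one_of_ne_bot D hγ hE hS1 hne'
  have htorF : Module.IsTorsion (IwasawaAlgebra p) (D.S ⧸ heegnerModule D F) :=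
    isTorsion_quotient_heegnerModule_of_smul_stabilizedHeegnerModule_le D F C hg hrev htorC
  -- forward envelope on ideals
  obtain ⟨n, henv⟩ :=
    exists_span_pow_mul_heegnerCharIdeal_le_stabilizedHeegnerCharIdeal_of_pow_smul_le D F C 0 hfwd' htorF
  refine ⟨D, F, X, m * 2 + n * 2, hFDt, hFβ, hSfin, hS1, htorF, ?_⟩
  calc Ideal.span {((p : IwasawaAlgebra p) ^ (m * 2 + n * 2))} * heegnerCharIdeal D F ^ 2
      = Ideal.span {((p : IwasawaAlgebra p) ^ (m * 2))} *
          (Ideal.span {((p : IwasawaAlgebra p) ^ n)} * heegnerCharIdeal D F) ^ 2 := by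
        rw [span_singleton_mul_sq, ← pow_mul, ← pow_add]
    _ ≤ Ideal.span {((p : IwasawaAlgebra p) ^ (m * 2))} * stabilizedHeegnerCharIdeal D C ^ 2 :=
        Ideal.mul_mono_right (Ideal.pow_right_mono henv 2)
    _ ≤ _ := hm

/-! ## §2 On an ARBITRARY X10b Heegner frame of the crux (odd or even `d_K`, any class number) -/

/-- **The untied containment on ANY X10b Heegner frame of 23729, for a given `jbar`, from Thm. 6.5.1 and a Kolyvagin system
at the frame** (`hKSAt` as in §1, with (h1) the theorem `X10.noPTorsion_baseChange_of_classX10`): the fields of §1 are theorems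
on class X10b; the μ-blind promotion `PrintX9Rescaling.howardContainment_of_localized_family` (`F := p^m • F₀`) finishes.
[cite: CastellaGrossiSkinner2025, Thm. 6.5.1] [cite: CastellaGrossiLeeSkinner2022, Thm. 4.1.1, §3.2 (h1)]
[cite: Howard2004HeegnerKolyvagin, §1 ("Fixing a modular parametrization"), Thm. B] -/
theorem howardContainmentAnyClassNumberX10b_at_of_thm651_of_ksAt
    (h651 : CastellaGrossiSkinner2025.thm651_rankOne_charIdeal_torsion_dvd_pLocalized_of_kolyvaginSystem)
    {W : WeierstrassCurve ℚ} [W.IsElliptic] [W.IsGloballyMinimal] {p : ℕ} [Fact p.Prime]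
    [NeZero (W.conductorNorm ℤ)] {K : Type} [Field K] [NumberField K]
    (hX : ClassX10 W p) (hK : IsImaginaryQuadratic K) (h3 : NumberField.discr K ≠ -3) (h4 : NumberField.discr K ≠ -4)
    (hHN : SatisfiesHeegnerHypothesis (W.conductorNorm ℤ) K) (hHp : SatisfiesHeegnerHypothesis p K)
    {κ : ZpExtension K p} (hac : κ.IsAnticyclotomic) {γ : Field.absoluteGaloisGroup K} (hγ : κ.IsTopGenerator γ)
    (Dt : ModularParametrizationData W (W.conductorNorm ℤ))
    (H : HeegnerDatum (W.conductorNorm ℤ) (NumberField.discr K)) (jbar : AlgebraicClosure K →+* ℂ)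
    (hKSAt : ∀ (D : (W.baseChange K).LambdaAdicSelmerData κ γ) (C : StabilizedHeegnerData (W.conductorNorm ℤ) W K κ jbar)
      (z : D.S) (_hz : ∀ (k : ℕ) (hk : C.depth < k), D.proj k z ∈ stabilizedClassLayer C k hk)
      (π : ∀ v : HeightOneSpectrum (𝓞 K), TamePin v)
      (P : Finset (HeightOneSpectrum (𝓞 K)) → HeightOneSpectrum (𝓞 K) → Prop)
      (hP : ∀ j n v, P n v → TameHyp (fun n ↦ W.shapiroLevelQuot (κ.unitTwist (-1)) j n) n v)
      (_hPlev : ∀ n ∈ levels (heegnerKolyvaginPrimes W (κ.unitTwist (-1))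
          (placesDividing K (p * W.conductorNorm ℤ) mul_level_ne_zero)), ∀ v ∈ n, P n v)
      (cd : ConjugationDatum K),
      letI := W.shapiroResidueModule K p
      ∀ (πbar : ∀ j, W.ShapiroLevel K p j →ₗ[IwasawaAlgebra p ⧸ shapiroIdeal p (j + 1)] (W.baseChange K).geomTorsion (p : ℤ))
        (Dsrc : ∀ j, DualityDatum p cd ((W.shapiroTower K p (κ.unitTwist (-1))).ρ j) (IwasawaAlgebra p ⧸ shapiroIdeal p (j + 1))),
      ∃ κKS : (CastellaGrossiSkinner2025.thm651Setting (W.conductorNorm ℤ) W K p κ rfl jbar π P hP cd πbar Dsrc).KolyvaginSystem,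
        κKS.one ≠ 0 ∧
        (∃ a : IwasawaAlgebra p, κKS.one = (W.shapiroTower K p (κ.unitTwist (-1))).smulFamily a
          (W.toShapiroSuccLimitH1 D hγ
            (Summit.BirchSwinnertonDyer.BirchSwinnertonDyer.Rank1Residual.X10.noPTorsion_baseChange_of_classX10 hX hK.1) z).1) ∧
        (∃ b : IwasawaAlgebra p,
          (W.toShapiroSuccLimitH1 D hγ
            (Summit.BirchSwinnertonDyer.BirchSwinnertonDyer.Rank1Residual.X10.noPTorsion_baseChange_of_classX10 hX hK.1) z).1 =
          (W.shapiroTower K p (κ.unitTwist (-1))).smulFamily b κKS.one)) :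
    ∃ (D : (W.baseChange K).LambdaAdicSelmerData κ γ) (F : HeegnerFamily (W.conductorNorm ℤ) W K κ jbar)
      (X : (W.baseChange K).SelmerDualData κ γ),
      heegnerCharIdeal D F ^ 2 ≤
        Module.charIdeal (IwasawaAlgebra p) (Submodule.torsion (IwasawaAlgebra p) X.X) := by
  have hE := Summit.BirchSwinnertonDyer.BirchSwinnertonDyer.Rank1Residual.X10.noPTorsion_baseChange_of_classX10 hX hK.1
  obtain ⟨D, F₀, X, m, -, -, hSfin, hS1, htorF, hm⟩ :=
    howardContainment_untied_localized_of_thm651_of_ksAt h651 hX.ne_two hX.isOrdinaryAt hX.not_dvd_conductorNorm hK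
      (PrintX10bEvenDiscOfCornutVatsal.discr_lt_neg_four_of_ne hK h3 h4) hHN hHp hE hac hγ jbar Dt H hKSAt
  haveI : Module.Finite (IwasawaAlgebra p) D.S := hSfin
  obtain ⟨F, hF⟩ := PrintX9Rescaling.howardContainment_of_localized_family D X F₀ m hSfin
    (fun n P hP hpP ↦ PrintX9Rescaling.fixedGeomPoints_eq_zero_of_smul_eq_zero_of_noPTorsion (W.baseChange K) κ
      hE n hP hpP)
    htorF (PrintX9Rescaling.exists_nonTorsion_mem_of_finrank_eq_one hS1 (heegnerModule D F₀) htorF) hm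
  exact ⟨D, F, X, hF⟩

/-! ## §3 On ODD-`d_K` frames the frame-local hypothesis IS the leaf F-411 (`CGLSHeegnerKolyvaginSystem`, 23236) -/

/-- **Kernel check**: on an odd-`d_K` X10b Heegner frame, CGLS 2022 Thm. 4.1.1 in Kolyvagin-system form (the route leaf
`CGLSHeegnerKolyvaginSystem` = `thm411_exists_kolyvaginSystem_one_ne_zero`) at the frame's record
`X10.thm413Hypotheses_of_classX10` delivers the hypothesis `hKSAt` of §1–§2 — the settings agree by
`CastellaGrossiSkinner2025.thm411Setting_eq_thm651Setting` (`rfl`). So the new hypothesis differs from typed print exactly on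
the even-`d_K` frames. [cite: CastellaGrossiLeeSkinner2022, Thm. 4.1.1 and Rem. 4.1.4] [cite: CastellaGrossiSkinner2025, Thm. 6.5.2 lead-in (l.3229)] -/
theorem ksAt_oddDisc_of_kolyvaginSystemLeaf (hKS : CGLSHeegnerKolyvaginSystem)
    {W : WeierstrassCurve ℚ} [W.IsElliptic] [W.IsGloballyMinimal] {p : ℕ} [Fact p.Prime]
    [NeZero (W.conductorNorm ℤ)] {K : Type} [Field K] [NumberField K]
    (hX : ClassX10 W p) (hK : IsImaginaryQuadratic K) (h3 : NumberField.discr K ≠ -3)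
    (hHN : SatisfiesHeegnerHypothesis (W.conductorNorm ℤ) K) (hHp : SatisfiesHeegnerHypothesis p K)
    (hodd : Odd (NumberField.discr K)) {κ : ZpExtension K p} (hac : κ.IsAnticyclotomic)
    {γ : Field.absoluteGaloisGroup K} (hγ : κ.IsTopGenerator γ) (jbar : AlgebraicClosure K →+* ℂ)
    (D : (W.baseChange K).LambdaAdicSelmerData κ γ) (C : StabilizedHeegnerData (W.conductorNorm ℤ) W K κ jbar)
    (z : D.S) (hz : ∀ (k : ℕ) (hk : C.depth < k), D.proj k z ∈ stabilizedClassLayer C k hk)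
    (π : ∀ v : HeightOneSpectrum (𝓞 K), TamePin v)
    (P : Finset (HeightOneSpectrum (𝓞 K)) → HeightOneSpectrum (𝓞 K) → Prop)
    (hP : ∀ j n v, P n v → TameHyp (fun n ↦ W.shapiroLevelQuot (κ.unitTwist (-1)) j n) n v)
    (hPlev : ∀ n ∈ levels (heegnerKolyvaginPrimes W (κ.unitTwist (-1))
        (placesDividing K (p * W.conductorNorm ℤ) mul_level_ne_zero)), ∀ v ∈ n, P n v)
    (cd : ConjugationDatum K) :
    letI := W.shapiroResidueModule K p
    ∀ (πbar : ∀ j, W.ShapiroLevel K p j →ₗ[IwasawaAlgebra p ⧸ shapiroIdeal p (j + 1)] (W.baseChange K).geomTorsion (p : ℤ))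
      (Dsrc : ∀ j, DualityDatum p cd ((W.shapiroTower K p (κ.unitTwist (-1))).ρ j) (IwasawaAlgebra p ⧸ shapiroIdeal p (j + 1))),
    ∃ κKS : (CastellaGrossiSkinner2025.thm651Setting (W.conductorNorm ℤ) W K p κ rfl jbar π P hP cd πbar Dsrc).KolyvaginSystem,
      κKS.one ≠ 0 ∧
      (∃ a : IwasawaAlgebra p, κKS.one = (W.shapiroTower K p (κ.unitTwist (-1))).smulFamily a
        (W.toShapiroSuccLimitH1 D hγ
          (Summit.BirchSwinnertonDyer.BirchSwinnertonDyer.Rank1Residual.X10.noPTorsion_baseChange_of_classX10 hX hK.1) z).1) ∧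
      (∃ b : IwasawaAlgebra p,
        (W.toShapiroSuccLimitH1 D hγ
          (Summit.BirchSwinnertonDyer.BirchSwinnertonDyer.Rank1Residual.X10.noPTorsion_baseChange_of_classX10 hX hK.1) z).1 =
        (W.shapiroTower K p (κ.unitTwist (-1))).smulFamily b κKS.one) := by
  intro πbar Dsrc
  have h411 : thm411_exists_kolyvaginSystem_one_ne_zero := hKS
  exact h411 (W.conductorNorm ℤ) W K p κ γ jbar
    (Summit.BirchSwinnertonDyer.BirchSwinnertonDyer.Rank1Residual.X10.thm413Hypotheses_of_classX10 hX hK h3 hHN hHp hodd hac hγ)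
    D C z hz π P hP hPlev cd πbar Dsrc

/-! ## §4 CENSUS III: 23729 BY NAME ⟸ Thm. 6.5.1 + F-411 (odd `d_K`) + MZ Cor. 4.6 (`3 ∤ h_K`) + «the Kolyvagin system exists on the `R_even` frames» -/

/-- **CENSUS III — `HowardContainmentAnyClassNumberX10b` (stmt-BirchSwinnertonDyer-23729) BY NAME from three cite-only print
leaves and ONE residual.** Leaves: CGS 2025 Thm. 6.5.1 (`h651`, record-free, p699162), CGLS 2022 Thm. 4.1.1 in KS form
(`hKS` = `CGLSHeegnerKolyvaginSystem`, 23236), Mastella–Zerman 2026 Cor. 4.6 (`hMZ` = `MastellaZermanHowardDivisibility`, 25233).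
Residual `KS^{R_even}` (`hKSE`): the binders of 23729 VERBATIM, then `¬ Odd (NumberField.discr K)`, `p ∣ NumberField.classNumber K`,
`(hE : E(K)[p] = 0)` (a theorem on class X10b, taken as a binder to keep the text record-free), then F-411's body over
`thm651Setting` for every `jbar D C z` and every choice of presentation slots — «the Heegner-point Kolyvagin system with
`κ₁ ≠ 0` on the line of `Φ′(κ_∞(C))` EXISTS on the X10b frames with `d_K` even (`≠ -4`) and `3 ∣ h_K`». Split: odd `d_K` ↦
§3 + §2; even `d_K`, `3 ∤ h_K` ↦ MZ26 (`X10.heegnerContainment_of_cor46_of_not_surj`); even `d_K`, `3 ∣ h_K` ↦ `hKSE` + §2.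
CONDITIONAL; credits nothing by itself. [cite: CastellaGrossiSkinner2025, Thm. 6.5.1] [cite: CastellaGrossiLeeSkinner2022, Thm. 4.1.1, §4.1 (disc)]
[cite: MastellaZerman2026, Cor. 4.6] [cite: Howard2004HeegnerKolyvagin, §2.3 (the construction), Thm. 2.3.1] -/
theorem howardContainmentAnyClassNumberX10b_of_thm651_ksLeaf_mz_of_ksOnEvenFrames
    (h651 : CastellaGrossiSkinner2025.thm651_rankOne_charIdeal_torsion_dvd_pLocalized_of_kolyvaginSystem)
    (hKS : CGLSHeegnerKolyvaginSystem) (hMZ : MastellaZermanHowardDivisibility)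
    (hKSE : ∀ (W : WeierstrassCurve ℚ) [W.IsElliptic] [W.IsGloballyMinimal] (p : ℕ) [Fact p.Prime]
      [NeZero (W.conductorNorm ℤ)] (K : Type) [Field K] [NumberField K],
      ClassX10 W p → ¬ Surj W 3 → ¬ W.HasCM →
      IsImaginaryQuadratic K → NumberField.discr K ≠ -3 → NumberField.discr K ≠ -4 →
      SatisfiesHeegnerHypothesis (W.conductorNorm ℤ) K → SatisfiesHeegnerHypothesis p K →
      ∀ (κ : ZpExtension K p), κ.IsAnticyclotomic → ∀ (γ : Field.absoluteGaloisGroup K) (hγ : κ.IsTopGenerator γ),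
      ¬ Odd (NumberField.discr K) → p ∣ NumberField.classNumber K →
      ∀ (hE : ∀ Q : (W.baseChange K).toAffine.Point, p • Q = 0 → Q = 0)
        (jbar : AlgebraicClosure K →+* ℂ) (D : (W.baseChange K).LambdaAdicSelmerData κ γ)
        (C : StabilizedHeegnerData (W.conductorNorm ℤ) W K κ jbar)
        (z : D.S) (_hz : ∀ (k : ℕ) (hk : C.depth < k), D.proj k z ∈ stabilizedClassLayer C k hk)
        (π : ∀ v : HeightOneSpectrum (𝓞 K), TamePin v)
        (P : Finset (HeightOneSpectrum (𝓞 K)) → HeightOneSpectrum (𝓞 K) → Prop)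
        (hP : ∀ j n v, P n v → TameHyp (fun n ↦ W.shapiroLevelQuot (κ.unitTwist (-1)) j n) n v)
        (_hPlev : ∀ n ∈ levels (heegnerKolyvaginPrimes W (κ.unitTwist (-1))
            (placesDividing K (p * W.conductorNorm ℤ) mul_level_ne_zero)), ∀ v ∈ n, P n v)
        (cd : ConjugationDatum K),
        letI := W.shapiroResidueModule K p
        ∀ (πbar : ∀ j, W.ShapiroLevel K p j →ₗ[IwasawaAlgebra p ⧸ shapiroIdeal p (j + 1)] (W.baseChange K).geomTorsion (p : ℤ))
          (Dsrc : ∀ j, DualityDatum p cd ((W.shapiroTower K p (κ.unitTwist (-1))).ρ j)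
            (IwasawaAlgebra p ⧸ shapiroIdeal p (j + 1))),
        ∃ κKS : (CastellaGrossiSkinner2025.thm651Setting (W.conductorNorm ℤ) W K p κ rfl jbar π P hP cd πbar Dsrc).KolyvaginSystem,
          κKS.one ≠ 0 ∧
          (∃ a : IwasawaAlgebra p, κKS.one =
            (W.shapiroTower K p (κ.unitTwist (-1))).smulFamily a (W.toShapiroSuccLimitH1 D hγ hE z).1) ∧
          (∃ b : IwasawaAlgebra p, (W.toShapiroSuccLimitH1 D hγ hE z).1 =
            (W.shapiroTower K p (κ.unitTwist (-1))).smulFamily b κKS.one)) :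
    HowardContainmentAnyClassNumberX10b := by
  intro W _ _ p _ _ K _ _ hX hns hcm hK h3 h4 hHN hHp κ hκ γ hγ Dt H ιC
  by_cases hodd : Odd (NumberField.discr K)
  · letI : Algebra K ℂ := ιC.toAlgebra
    let jbar : AlgebraicClosure K →+* ℂ :=
      (IsAlgClosed.lift (R := K) (M := ℂ) (S := AlgebraicClosure K)).toRingHom
    obtain ⟨D, F, X, h⟩ := howardContainmentAnyClassNumberX10b_at_of_thm651_of_ksAt h651 hX hK h3 h4 hHN hHp hκ hγ Dt H jbar
      (fun D C z hz π P hP hPlev cd ↦ ksAt_oddDisc_of_kolyvaginSystemLeaf hKS hX hK h3 hHN hHp hodd hκ hγ jbar D C z hz π P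
        hP hPlev cd)
    exact ⟨jbar, D, F, X, h⟩
  · by_cases hh : p ∣ NumberField.classNumber K
    · letI : Algebra K ℂ := ιC.toAlgebra
      let jbar : AlgebraicClosure K →+* ℂ :=
        (IsAlgClosed.lift (R := K) (M := ℂ) (S := AlgebraicClosure K)).toRingHom
      obtain ⟨D, F, X, h⟩ := howardContainmentAnyClassNumberX10b_at_of_thm651_of_ksAt h651 hX hK h3 h4 hHN hHp hκ hγ Dt H
        jbar (hKSE W p K hX hns hcm hK h3 h4 hHN hHp κ hκ γ hγ hodd hh _ jbar)
      exact ⟨jbar, D, F, X, h⟩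
    · have h46 : MastellaZerman2026.cor46_howardDivisibility_of_scalarImage.{0} := hMZ
      exact Summit.BirchSwinnertonDyer.BirchSwinnertonDyer.Rank1Residual.X10.heegnerContainment_of_cor46_of_not_surj h46
        hX hns hcm hK h3 h4 hHN hHp hh κ hκ γ hγ Dt H ιC

end Summit.BirchSwinnertonDyer.BirchSwinnertonDyer.Theorems.PrintX10bOfKSBound

end
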